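import Summits.CriticalPhenomena.PercolationContinuityZ3.Theorems.PercNearOneGluingNoHeavyLowerTailSunflowerMultiPetalKempeMarkedStep
import HarnessLib
import HarnessLib.Audit

/-!
# `NoHeavyLowerTail` (crux stmt-CriticalPhenomena-4575), marked-multigraph layer: **THEOREM L1 for `|S| = 1`** — the neighbourhood-contraction
# step law when the deleted vertex has exactly ONE outer neighbour (kernel-checked)

Support file (seat `prim-l12-p2` gen 49; `--supports stmt-CriticalPhenomena-4575`; continuation of `…KempeMarkedStep` (p597137: `TfunM_step` for
`|S| ≥ 2`, `TfunM_step_zero` for `S = ∅`)).  No `sorry`; nothing is asserted about the crux.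
Memo: run/shared/lean/prim/prim-l12/prim-l12-p2/FINDING-g47-NEIGHBOURHOOD-CONTRACTION-STEP.md §3 (vii), §6 (a); PROOF-LEMMA-B-MARKED-MULTIGRAPHS-g47.md §2 (vii).

For a marked multigraph `K`, terminals `u ≠ v`, an UNMARKED non-terminal `y` with `mul y u ≠ 0` and exactly one further neighbour `s ∉ {u, v}`
(`S = {s}`), **`TfunM_step_one`**: `3·T(K.isolate y) + T(K.peelContract y {s} u) ≤ 9·T(K)`, i.e. `T(K − y) + T((K − y)/(s → u)) ≤ T(K)`.
Together with p597137 this is the step law for EVERY outer degree, which is what the Lemma-B induction consumes.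

PROOF (memo §3 (vii), the `d = 1` enumeration of `smalld.c`, here kernel-checked).  Group the colourings `ρ` of `K − y` with the terminal colours
into ROWS `{ρ[s ↦ 0], ρ[s ↦ 1], ρ[s ↦ 2]}`; the row sum of the cell residual `resCell` (p595450) is a function `rowD1` of the capped type
`t₀` of `K − y − s` at `ρ`, the capped profile `φ` of `s` in `K − y`, and the flags `(A,B,C) = (mul y u, mul y v, mul y s) ∧ 2`.  Pair the row of
`ρ` with the row of `Φ_u ρ` (swap `0 ↔ 2` off `u`): with `t₀ = (Ia ⊕ P, B₁, Ic)` the partner has `t₀' = (Ic ⊕ P', B₁, Ia)`, and with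
`φ = (N ⊕ Θa, Θb, Θc)` the partner has `φ' = (N ⊕ Θc, Θb, Θa)` (`N = mul s u ∧ 2`); the paired inequality `rowD1 t₀ φ + rowD1 t₀' φ' ≥ 0` over
all `3⁹` parameters and the `12` flag classes is the finite check `single_pair_nonneg` (evaluated through `ℕ`-indexed tables `lbN`/`fCN`/`kerN`/`rowN`,
which the kernel reduces ~25× faster than the `Fin 3` definitions; the tables are proved equal to `lbW`/`fC`/`kerTAbs`).
-/

namespace Summit.CriticalPhenomena.PercolationContinuityZ3.Theorems.SunflowerPartition.Kempe

open Finset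

/-! ## ℕ-indexed evaluation tables for the finite check -/

/-- `lbW` as an `ℕ`-indexed table (fast kernel reduction). [this work] -/
def lbN : ℕ → ℕ → ℕ → ℤ
  | 2, 0, 0 => 2
  | 0, 2, 0 => 2
  | 0, 0, 2 => 2
  | 0, 1, 1 => -1
  | 1, 0, 1 => -1
  | 1, 1, 0 => -1
  | 1, 1, 1 => -1
  | _, _, _ => 0

/-- Capping at `2` on `ℕ`. [this work] -/
def cap2 (n : ℕ) : ℕ := if n ≤ 2 then n else 2

/-- `fC` as an `ℕ`-indexed table. [this work] -/
def fCN (a b c : ℕ) : ℤ := lbN (cap2 (a + 1)) b c + lbN a (cap2 (b + 1)) c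

/-- `kerTAbs` as an `ℕ`-indexed table. [this work] -/
def kerN (a b c d₀ d₁ d₂ : ℕ) : ℤ :=
  fCN (cap2 (a + d₀)) b c + fCN a (cap2 (b + d₁)) c + fCN a b (cap2 (c + d₂)) - fCN a b c

/-- The `|S| = 1` row (`ℕ`-indexed): cells `s ↦ 0` (with the contraction term `−fC`), `s ↦ 1`, `s ↦ 2`. [this work] -/
def rowN (t₀ t₁ t₂ p₀ p₁ p₂ A B C : ℕ) : ℤ :=
  (kerN (cap2 (t₀ + p₀)) t₁ t₂ (cap2 (A + C)) B 0 - fCN (cap2 (t₀ + p₀)) t₁ t₂)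
    + kerN t₀ (cap2 (t₁ + p₁)) t₂ A (cap2 (B + C)) 0 + kerN t₀ t₁ (cap2 (t₂ + p₂)) A B C

/-- `lbN` agrees with `lbW`. (finite check) [this work] -/
theorem lbN_val : ∀ t : CType, lbN t.1.val t.2.1.val t.2.2.val = lbW t := by decide

/-- `cap2` agrees with `capAdd`. (finite check) [this work] -/
theorem cap2_val : ∀ a b : Fin 3, cap2 (a.val + b.val) = (capAdd a b).val := by decide

/-- `fCN` agrees with `fC`. (finite check) [this work] -/
theorem fCN_val : ∀ t : CType, fCN t.1.val t.2.1.val t.2.2.val = fC t := by decide +kernel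

/-- `kerN` agrees with `kerTAbs`. (finite check) [this work] -/
theorem kerN_val : ∀ t d : CType, kerN t.1.val t.2.1.val t.2.2.val d.1.val d.2.1.val d.2.2.val = kerTAbs t d := by decide +kernel

/-- The `|S| = 1` ROW of the cell residual at base type `t` (of `K − y − s`), profile `φ` of `s` (in `K − y`) and flags `(A,B,C)`:
`[kerTAbs (t ⊕ φ₀e₀) (A⊕C, B, 0) − fC (t ⊕ φ₀e₀)] + kerTAbs (t ⊕ φ₁e₁) (A, B⊕C, 0) + kerTAbs (t ⊕ φ₂e₂) (A, B, C)`. [this work] -/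
def rowD1 (t φ : CType) (A B C : Fin 3) : ℤ :=
  (kerTAbs (ctAdd t (xPart 0 φ)) (capAdd A C, B, 0) - fC (ctAdd t (xPart 0 φ)))
    + kerTAbs (ctAdd t (xPart 1 φ)) (A, capAdd B C, 0) + kerTAbs (ctAdd t (xPart 2 φ)) (A, B, C)

/-- `xPart 0`. (finite check) [this work] -/
theorem xPart_zero_eq : ∀ d : CType, xPart 0 d = (d.1, 0, 0) := by decide
/-- `xPart 1`. (finite check) [this work] -/
theorem xPart_one_eq : ∀ d : CType, xPart 1 d = (0, d.2.1, 0) := by decide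
/-- `xPart 2`. (finite check) [this work] -/
theorem xPart_two_eq : ∀ d : CType, xPart 2 d = (0, 0, d.2.2) := by decide

/-- `rowD1` evaluates through the `ℕ`-indexed table `rowN`. [this work] -/
theorem rowD1_eq_rowN (t φ : CType) (A B C : Fin 3) :
    rowD1 t φ A B C = rowN t.1.val t.2.1.val t.2.2.val φ.1.val φ.2.1.val φ.2.2.val A.val B.val C.val := by
  obtain ⟨t₀, t₁, t₂⟩ := t
  obtain ⟨p₀, p₁, p₂⟩ := φ
  unfold rowD1 rowN
  rw [xPart_zero_eq, xPart_one_eq, xPart_two_eq]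
  unfold ctAdd
  simp only [MGraph.capAdd_zero_right]
  rw [← kerN_val, ← kerN_val, ← kerN_val, ← fCN_val]
  simp only [← cap2_val, Fin.val_zero]

/-- **The paired `|S| = 1` inequality, `ℕ`-indexed form** (`3⁹ × 12` cases). (finite check, kernel reduction) [this work] -/
theorem single_pair_nonnegN : ∀ A : Fin 3, A ≠ 0 → ∀ C : Fin 3, C ≠ 0 → ∀ B Ia Ic P P' B₁ N Ta Tb Tc : Fin 3,
    0 ≤ rowN (cap2 (Ia.val + P.val)) B₁.val Ic.val (cap2 (N.val + Ta.val)) Tb.val Tc.val A.val B.val C.val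
      + rowN (cap2 (Ic.val + P'.val)) B₁.val Ia.val (cap2 (N.val + Tc.val)) Tb.val Ta.val A.val B.val C.val := by
  decide +kernel

/-- **THE PAIRED `|S| = 1` INEQUALITY** (memo §3 (vii)): for every base parameters and flags `A ≠ 0` (`y ∼ u`), `C ≠ 0` (`y ∼ s`),
`rowD1 (Ia⊕P, B₁, Ic) (N⊕Θa, Θb, Θc) + rowD1 (Ic⊕P', B₁, Ia) (N⊕Θc, Θb, Θa) ≥ 0` — the row of a colouring plus the row of its `Φ_u`-partner. [this work] -/
theorem single_pair_nonneg (A B C : Fin 3) (hA : A ≠ 0) (hC : C ≠ 0) (Ia Ic P P' B₁ N Ta Tb Tc : Fin 3) :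
    0 ≤ rowD1 (capAdd Ia P, B₁, Ic) (capAdd N Ta, Tb, Tc) A B C + rowD1 (capAdd Ic P', B₁, Ia) (capAdd N Tc, Tb, Ta) A B C := by
  rw [rowD1_eq_rowN, rowD1_eq_rowN]
  simp only [← cap2_val]
  exact single_pair_nonnegN A hA C hC B Ia Ic P P' B₁ N Ta Tb Tc


namespace MGraph

variable {V : Type*} [Fintype V] [LinearOrder V] (K : MGraph V)

/-! ## Bookkeeping lemmas: three-to-one at an arbitrary colour, links at the outer neighbour -/

section LinkLemmas

/-- Three-to-one for an arbitrary colour `c` at `x ∉ {u,v}`: summing `G (ρ[x ↦ c])` over the terminal-coloured colourings counts every colouring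
with `ρ x = c` three times. [this work] -/
theorem sum_update_eq_three_mul_col (x u v : V) (hux : u ≠ x) (hvx : v ≠ x) (c : Fin 3) (G : (V → Fin 3) → ℤ) :
    ∑ ρ ∈ univ.filter (fun ρ : V → Fin 3 => ρ u = 0 ∧ ρ v = 1), G (Function.update ρ x c)
      = 3 * ∑ ρ ∈ univ.filter (fun ρ : V → Fin 3 => ρ u = 0 ∧ ρ v = 1), (if ρ x = c then G ρ else 0) := by
  rw [sum_terminal_eq_sum_extCol x u v hux hvx, sum_terminal_eq_sum_extCol x u v hux hvx, mul_sum]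
  refine sum_congr rfl fun τ _ => ?_
  simp only [update_extCol, extCol_self]
  rw [sum_const, card_univ, Fintype.card_fin, sum_ite_eq' univ c, if_pos (mem_univ _)]
  simp

/-- The link of a vertex `s ≠ u` splits into its `u`-term and its link in `K.isolate u`. [this work] -/
theorem linkM_eq_uterm_add (s u : V) (hsu : s ≠ u) (ρ : V → Fin 3) (c : Fin 3) :
    K.linkM s ρ c = (if ρ u = c then K.mul s u else 0) + (K.isolate u).linkM s ρ c := by
  unfold linkM
  have key : ∀ w : V, (if ρ w = c then K.mul s w else 0)
      = (if w = u then (if ρ u = c then K.mul s u else 0) else 0) + (if ρ w = c then (K.isolate u).mul s w else 0) := by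
    intro w
    by_cases hw : w = u
    · subst hw
      by_cases hc : ρ w = c
      · simp [isolate, hc]
      · simp [hc]
    · by_cases hc : ρ w = c
      · simp [isolate, hc, hw, hsu]
      · simp [hc, hw]
  rw [sum_congr rfl (fun w _ => key w), sum_add_distrib, sum_ite_eq' univ u, if_pos (mem_univ _)]

/-- In `K.isolate u`, the link of `s` under `Φ_u ρ` is the colour-swapped link of `s` under `ρ`. [this work] -/
theorem linkM_isolate_phiU (s u : V) (ρ : V → Fin 3) (c : Fin 3) :
    (K.isolate u).linkM s (phiU u ρ) c = (K.isolate u).linkM s ρ (sw02 c) := by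
  unfold linkM
  refine sum_congr rfl fun w _ => ?_
  by_cases hw : w = u
  · subst hw; simp [isolate]
  · rw [phiU_of_ne u ρ hw]
    have : (sw02 (ρ w) = c) ↔ (ρ w = sw02 c) := by
      constructor
      · intro h; rw [← h, sw02_sw02]
      · intro h; rw [h, sw02_sw02]
    simp only [this]

/-- The link of `s` ignores the colour of `s`. [this work] -/
theorem linkM_update_self (s : V) (ρ : V → Fin 3) (c d : Fin 3) : K.linkM s (Function.update ρ s c) d = K.linkM s ρ d := by
  unfold linkM
  refine sum_congr rfl fun w _ => ?_
  by_cases hw : w = s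
  · subst hw; simp [K.loopless]
  · rw [Function.update_of_ne hw]

/-- The profile of `s` ignores the colour of `s`. [this work] -/
theorem profM_update_self (s : V) (ρ : V → Fin 3) (c : Fin 3) : K.profM s (Function.update ρ s c) = K.profM s ρ := by
  unfold profM
  rw [K.linkM_update_self s ρ c 0, K.linkM_update_self s ρ c 1, K.linkM_update_self s ρ c 2]

/-- The type in `K.isolate s` ignores the colour of `s`. [this work] -/
theorem ctypeM_isolate_update (s : V) (ρ : V → Fin 3) (c : Fin 3) :
    (K.isolate s).ctypeM (Function.update ρ s c) = (K.isolate s).ctypeM ρ := by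
  unfold ctypeM
  rw [cntM_isolate_update K s ρ c 0, cntM_isolate_update K s ρ c 1, cntM_isolate_update K s ρ c 2]

/-- **Base type and its `Φ_u`-partner** (for `ρ u = 0`): `t₀ = (Ia ⊕ P, B₁, Ic)` and `t₀(Φ_u ρ) = (Ic ⊕ P', B₁, Ia)` with `Ia, Ic` the internal
`0`- and `2`-counts (members avoiding `u`), `P, P'` the `0`- resp. `2`-coloured link of `u` plus its marks, `B₁` the `1`-count. [this work] -/
theorem ctypeM_pair (u : V) (ρ : V → Fin 3) (hu : ρ u = 0) :
    K.ctypeM ρ = (capAdd (cap3 ((K.isolate u).cntM ρ 0)) (cap3 (K.linkM u ρ 0 + K.mark u)), cap3 (K.cntM ρ 1), cap3 ((K.isolate u).cntM ρ 2)) ∧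
    K.ctypeM (phiU u ρ)
      = (capAdd (cap3 ((K.isolate u).cntM ρ 2)) (cap3 (K.linkM u ρ 2 + K.mark u)), cap3 (K.cntM ρ 1), cap3 ((K.isolate u).cntM ρ 0)) := by
  have d0 := K.cntM_eq_isolate_add u ρ 0
  have d2 := K.cntM_eq_isolate_add u ρ 2
  have h02 : ¬((0 : Fin 3) = 2) := by decide
  rw [hu, if_pos rfl] at d0
  rw [hu, if_neg h02, add_zero] at d2
  have e1 := K.cntM_phiU_one u ρ hu
  have e2 := K.cntM_phiU_two u ρ hu
  have e0 := K.cntM_phiU_zero u ρ hu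
  have e2' : K.cntM (phiU u ρ) 2 = (K.isolate u).cntM ρ 0 := by omega
  constructor
  · unfold ctypeM
    rw [d0, cap3_add, d2]
  · unfold ctypeM
    rw [e1, e0, d2, cap3_add, e2']

/-- **Profile of `s ≠ u` and of its `Φ_u`-partner** (for `ρ u = 0`): `φ = (N ⊕ Θa, Θb, Θc)` and `φ(Φ_u ρ) = (N ⊕ Θc, Θb, Θa)` with `N = mul s u ∧ 2`
and `Θ` the link of `s` away from `u` plus the marks of `s`. [this work] -/
theorem profM_pair (s u : V) (hsu : s ≠ u) (ρ : V → Fin 3) (hu : ρ u = 0) :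
    K.profM s ρ = (capAdd (cap3 (K.mul s u)) (cap3 ((K.isolate u).linkM s ρ 0 + K.mark s)),
        cap3 ((K.isolate u).linkM s ρ 1 + K.mark s), cap3 ((K.isolate u).linkM s ρ 2 + K.mark s)) ∧
    K.profM s (phiU u ρ) = (capAdd (cap3 (K.mul s u)) (cap3 ((K.isolate u).linkM s ρ 2 + K.mark s)),
        cap3 ((K.isolate u).linkM s ρ 1 + K.mark s), cap3 ((K.isolate u).linkM s ρ 0 + K.mark s)) := by
  have hl := fun c => K.linkM_eq_uterm_add s u hsu ρ c
  have hl' := fun c => K.linkM_eq_uterm_add s u hsu (phiU u ρ) c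
  have hφ := fun c => K.linkM_isolate_phiU s u ρ c
  have hφu : phiU u ρ u = 0 := by rw [phiU_self, hu]
  have h01 : ¬((0 : Fin 3) = 1) := by decide
  have h02 : ¬((0 : Fin 3) = 2) := by decide
  have s0 : sw02 0 = 2 := by decide
  have s1 : sw02 1 = 1 := by decide
  have s2 : sw02 2 = 0 := by decide
  unfold profM
  constructor
  · rw [hl 0, hl 1, hl 2, hu, if_pos rfl, if_neg h01, if_neg h02, zero_add, zero_add, add_assoc, cap3_add]
  · rw [hl' 0, hl' 1, hl' 2, hφu, if_pos rfl, if_neg h01, if_neg h02, zero_add, zero_add, hφ 0, hφ 1, hφ 2, s0, s1, s2,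
      add_assoc, cap3_add]

end LinkLemmas

/-! ## The `|S| = 1` step law -/

section StepOne

variable {K}
variable {u v y s : V}

/-- The profile of `y` at the row cell `ρ[s ↦ c]` (`N(y) ⊆ {u, v, s}`, `ρ u = 0`, `ρ v = 1`, `y` unmarked): with `(A,B,C) = (mul y u, mul y v, mul y s) ∧ 2`
it is `(A ⊕ [c=0]C, B ⊕ [c=1]C, [c=2]C)`. [this work] -/
theorem profM_update_eq (hS : ∀ w, w ∈ ({s} : Finset V) ↔ (w ≠ u ∧ w ≠ v ∧ w ≠ y ∧ K.mul y w ≠ 0)) (huv : u ≠ v) (hyu : y ≠ u) (hyv : y ≠ v)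
    (hmy : K.mark y = 0) (ρ : V → Fin 3) (hu : ρ u = 0) (hv : ρ v = 1) (c : Fin 3) :
    K.profM y (Function.update ρ s c)
      = (capAdd (cap3 (K.mul y u)) (if c = 0 then cap3 (K.mul y s) else 0),
         capAdd (cap3 (K.mul y v)) (if c = 1 then cap3 (K.mul y s) else 0),
         if c = 2 then cap3 (K.mul y s) else 0) := by
  have hsu : s ≠ u := ((hS s).1 (mem_singleton_self s)).1
  have hsv : s ≠ v := ((hS s).1 (mem_singleton_self s)).2.1
  have hl := fun d => linkM_eq_outer hS huv hyu hyv (Function.update ρ s c) d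
  have h10 : ¬((1 : Fin 3) = 0) := by decide
  have h01 : ¬((0 : Fin 3) = 1) := by decide
  have h02 : ¬((0 : Fin 3) = 2) := by decide
  have h12 : ¬((1 : Fin 3) = 2) := by decide
  unfold profM
  rw [hl 0, hl 1, hl 2, hmy]
  simp only [sum_singleton, Function.update_self, Function.update_of_ne (Ne.symm hsu), Function.update_of_ne (Ne.symm hsv), hu, hv,
    if_true, h10, h01, h02, h12, if_false, add_zero, zero_add, cap3_add, cap3_ite]

/-- **ROW IDENTITY**: the three cells `ρ[s ↦ 0], ρ[s ↦ 1], ρ[s ↦ 2]` of the residual of the law with `S = {s}` sum to `rowD1 t₀ φ A B C`, where `t₀` is the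
type of `ρ` in `K − y − s`, `φ` the profile of `s` in `K − y`, and `(A,B,C) = (mul y u, mul y v, mul y s) ∧ 2`. [this work] -/
theorem sum_resCell_update_eq (hS : ∀ w, w ∈ ({s} : Finset V) ↔ (w ≠ u ∧ w ≠ v ∧ w ≠ y ∧ K.mul y w ≠ 0)) (huv : u ≠ v) (hyu : y ≠ u)
    (hyv : y ≠ v) (hmy : K.mark y = 0) (ρ : V → Fin 3) (hu : ρ u = 0) (hv : ρ v = 1) :
    ∑ c : Fin 3, K.resCell y {s} (Function.update ρ s c)
      = rowD1 (((K.isolate y).isolate s).ctypeM ρ) ((K.isolate y).profM s ρ) (cap3 (K.mul y u)) (cap3 (K.mul y v)) (cap3 (K.mul y s)) := by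
  have ht : ∀ c, (K.isolate y).ctypeM (Function.update ρ s c)
      = ctAdd (((K.isolate y).isolate s).ctypeM ρ) (xPart c ((K.isolate y).profM s ρ)) := by
    intro c
    rw [(K.isolate y).ctypeM_eq_ctAdd_isolate s (Function.update ρ s c), Function.update_self, (K.isolate y).ctypeM_isolate_update s ρ c,
      (K.isolate y).profM_update_self s ρ c]
  have h10 : ¬((1 : Fin 3) = 0) := by decide
  have h20 : ¬((2 : Fin 3) = 0) := by decide
  have h01 : ¬((0 : Fin 3) = 1) := by decide
  have h02 : ¬((0 : Fin 3) = 2) := by decide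
  have h12 : ¬((1 : Fin 3) = 2) := by decide
  have h21 : ¬((2 : Fin 3) = 1) := by decide
  rw [Fin.sum_univ_three]
  unfold resCell rowD1
  rw [ht 0, ht 1, ht 2, profM_update_eq hS huv hyu hyv hmy ρ hu hv 0, profM_update_eq hS huv hyu hyv hmy ρ hu hv 1,
    profM_update_eq hS huv hyu hyv hmy ρ hu hv 2]
  simp only [mem_singleton, forall_eq, Function.update_self, if_true, h10, h20, h01, h02, h12, h21, if_false, MGraph.capAdd_zero_right,
    sub_zero]

/-- **ROW PAIR ≥ 0**: the row of `ρ` plus the row of `Φ_u ρ` is nonnegative (the finite check `single_pair_nonneg` at the graph's parameters). [this work] -/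
theorem row_pair_nonneg (hS : ∀ w, w ∈ ({s} : Finset V) ↔ (w ≠ u ∧ w ≠ v ∧ w ≠ y ∧ K.mul y w ≠ 0)) (huv : u ≠ v) (hyu : y ≠ u) (hyv : y ≠ v)
    (hmy : K.mark y = 0) (hyu' : K.mul y u ≠ 0) (ρ : V → Fin 3) (hu : ρ u = 0) (hv : ρ v = 1) :
    0 ≤ (∑ c : Fin 3, K.resCell y {s} (Function.update ρ s c)) + ∑ c : Fin 3, K.resCell y {s} (Function.update (phiU u ρ) s c) := by
  have hsu : s ≠ u := ((hS s).1 (mem_singleton_self s)).1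
  have hys : K.mul y s ≠ 0 := ((hS s).1 (mem_singleton_self s)).2.2.2
  have hφu : phiU u ρ u = 0 := by rw [phiU_self, hu]
  have hφv : phiU u ρ v = 1 := by rw [phiU_of_ne u ρ huv.symm, hv]; decide
  have hA : cap3 (K.mul y u) ≠ 0 := fun h => hyu' ((eq_zero_iff_cap3 _).2 h)
  have hC : cap3 (K.mul y s) ≠ 0 := fun h => hys ((eq_zero_iff_cap3 _).2 h)
  rw [sum_resCell_update_eq hS huv hyu hyv hmy ρ hu hv, sum_resCell_update_eq hS huv hyu hyv hmy (phiU u ρ) hφu hφv]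
  obtain ⟨t1, t2⟩ := ((K.isolate y).isolate s).ctypeM_pair u ρ hu
  obtain ⟨p1, p2⟩ := (K.isolate y).profM_pair s u hsu ρ hu
  rw [t1, t2, p1, p2]
  exact single_pair_nonneg _ _ _ hA hC _ _ _ _ _ _ _ _ _

/-- **The residual sum is nonnegative for `S = {s}`.** [this work] -/
theorem sum_resCell_nonneg_one (hS : ∀ w, w ∈ ({s} : Finset V) ↔ (w ≠ u ∧ w ≠ v ∧ w ≠ y ∧ K.mul y w ≠ 0)) (huv : u ≠ v) (hyu : y ≠ u)
    (hyv : y ≠ v) (hmy : K.mark y = 0) (hyu' : K.mul y u ≠ 0) :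
    0 ≤ ∑ ρ ∈ univ.filter (fun ρ : V → Fin 3 => ρ u = 0 ∧ ρ v = 1), K.resCell y {s} ρ := by
  have hsu : s ≠ u := ((hS s).1 (mem_singleton_self s)).1
  have hsv : s ≠ v := ((hS s).1 (mem_singleton_self s)).2.1
  set F := univ.filter (fun ρ : V → Fin 3 => ρ u = 0 ∧ ρ v = 1) with hF
  have memF : ∀ ρ, ρ ∈ F ↔ ρ u = 0 ∧ ρ v = 1 := fun ρ => by rw [hF, mem_filter]; simp
  -- rows: three-to-one
  have hrow : ∑ ρ ∈ F, ∑ c : Fin 3, K.resCell y {s} (Function.update ρ s c) = 3 * ∑ ρ ∈ F, K.resCell y {s} ρ := by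
    rw [sum_comm]
    have h3 : ∀ c : Fin 3, ∑ ρ ∈ F, K.resCell y {s} (Function.update ρ s c) = 3 * ∑ ρ ∈ F, (if ρ s = c then K.resCell y {s} ρ else 0) :=
      fun c => sum_update_eq_three_mul_col s u v hsu.symm hsv.symm c _
    simp only [h3]
    rw [← mul_sum, sum_comm]
    congr 1
    refine sum_congr rfl fun ρ _ => ?_
    rw [sum_ite_eq univ (ρ s), if_pos (mem_univ _)]
  -- pairing by the involution Φ_u
  have hperm : ∑ ρ ∈ F, ∑ c : Fin 3, K.resCell y {s} (Function.update (phiU u ρ) s c)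
      = ∑ ρ ∈ F, ∑ c : Fin 3, K.resCell y {s} (Function.update ρ s c) := by
    refine sum_nbij' (phiU u) (phiU u) (fun ρ hρ => ?_) (fun ρ hρ => ?_) (fun ρ _ => phiU_phiU u ρ) (fun ρ _ => phiU_phiU u ρ) (fun ρ _ => rfl)
    · obtain ⟨hu, hv⟩ := (memF ρ).1 hρ
      exact (memF _).2 ⟨by rw [phiU_self, hu], by rw [phiU_of_ne u ρ huv.symm, hv]; decide⟩
    · obtain ⟨hu, hv⟩ := (memF ρ).1 hρ
      exact (memF _).2 ⟨by rw [phiU_self, hu], by rw [phiU_of_ne u ρ huv.symm, hv]; decide⟩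
  have h2 : 0 ≤ 2 * ∑ ρ ∈ F, ∑ c : Fin 3, K.resCell y {s} (Function.update ρ s c) := by
    have hsum : (∑ ρ ∈ F, ∑ c : Fin 3, K.resCell y {s} (Function.update ρ s c)) + ∑ ρ ∈ F, ∑ c : Fin 3, K.resCell y {s} (Function.update ρ s c)
        = ∑ ρ ∈ F, ((∑ c : Fin 3, K.resCell y {s} (Function.update ρ s c)) + ∑ c : Fin 3, K.resCell y {s} (Function.update (phiU u ρ) s c)) := by
      rw [sum_add_distrib, hperm]
    rw [two_mul, hsum]
    refine sum_nonneg fun ρ hρ => ?_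
    obtain ⟨hu, hv⟩ := (memF ρ).1 hρ
    exact row_pair_nonneg hS huv hyu hyv hmy hyu' ρ hu hv
  rw [hrow] at h2
  linarith

/-- **THEOREM L1 FOR `|S| = 1` — kernel-checked**: for terminals `u ≠ v`, an UNMARKED non-terminal `y` with `mul y u ≠ 0` and exactly one outer
neighbour (`S = N(y) ∖ {u,v}` with `|S| = 1`), `3^{|S|}·T(K.isolate y) + T(K.peelContract y S u) ≤ 3^{|S|+1}·T(K)`, i.e.
`T(K − y) + T((K − y)/(S ∪ u → u)) ≤ T(K)`. [this work] -/
theorem TfunM_step_one (u v y : V) (huv : u ≠ v) (hyu : y ≠ u) (hyv : y ≠ v) (hmark : K.mark y = 0) (hadj : K.mul y u ≠ 0)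
    (S : Finset V) (hS : ∀ w, w ∈ S ↔ (w ≠ u ∧ w ≠ v ∧ w ≠ y ∧ K.mul y w ≠ 0)) (hone : S.card = 1) :
    3 ^ S.card * (K.isolate y).TfunM u v + (K.peelContract y S u).TfunM u v ≤ 3 ^ (S.card + 1) * K.TfunM u v := by
  obtain ⟨s, rfl⟩ := card_eq_one.1 hone
  have hsu : s ≠ u := ((hS s).1 (mem_singleton_self s)).1
  have hsv : s ≠ v := ((hS s).1 (mem_singleton_self s)).2.1
  have hsy : s ≠ y := ((hS s).1 (mem_singleton_self s)).2.2.1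
  have huS : u ∉ ({s} : Finset V) := fun h => hsu (mem_singleton.1 h).symm
  have hvS : v ∉ ({s} : Finset V) := fun h => hsv (mem_singleton.1 h).symm
  have hyS : y ∉ ({s} : Finset V) := fun h => hsy (mem_singleton.1 h).symm
  let u' : ({y}ᶜ : Set V) := ⟨u, Set.mem_compl_singleton_iff.mpr hyu.symm⟩
  let v' : ({y}ᶜ : Set V) := ⟨v, Set.mem_compl_singleton_iff.mpr hyv.symm⟩
  have h1 := K.sum_resCell_eq y {s} u' v'
  have h2 := sum_resCell_nonneg_one hS huv hyu hyv hmark hadj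
  have hB := K.TfunM_peelContract y u v {s} hyu.symm huS hyS hvS
  dsimp only [u', v'] at h1
  rw [h1] at h2
  rw [hB, card_singleton]
  norm_num
  linarith

end StepOne

end MGraph

end Summit.CriticalPhenomena.PercolationContinuityZ3.Theorems.SunflowerPartition.Kempe
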